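import Literature.Probability.RandomPlanarGeometry.WholePlaneSLE
import Literature.Probability.RandomPlanarGeometry.NaturalParametrization
import Literature.Probability.RandomPlanarGeometry.SLE
import HarnessLib

/-!
# Two-sided whole-plane SLE_κ through the origin, with its natural parametrisation

Topic `Probability/RandomPlanarGeometry`. Definition request `defn-TwoSidedWholePlaneSLE`
(route `SAWDimerizationRG`, items `FusionRigidity` / `CanonicalToChordal`): the conjectured
scaling limit of the two-sided infinite self-avoiding walk / infinite self-avoiding polygon
through `0` (Lawler–Schramm–Werner (2004), §3.4.6 and §4.3 Predictions 7–8) is, for `κ = 8/3`, the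
**two-sided whole-plane SLE_{8/3} from `∞` to `∞` through `0`, parametrised by `4/3`-dimensional
Minkowski content**. We formalise, for general `κ`:

* (from `NaturalParametrization`) Minkowski content and `IsNaturallyParametrized d γ`
  (Lawler–Rezaei (2015), §2.2, Thm 1.1; Zhan (2021), §2.3), the path operations `reroot`
  (`FusionMap`), `dilatePath`, `rotatePath`, `reversePath`, the windows `rootedWindow T`
  (`RootedCurve ℂ`) / `windowClass T` (`CurveClass ℂ`), and the law predicates
  `IsRerootInvariant`, `IsSelfSimilar`, `IsRotationInvariant`; (from `WholePlaneSLE`) whole-plane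
  SLE_κ(ρ) from `0` to `∞`, `IsWholePlaneSLEKappaRho`.
* **Two-sided whole-plane SLE_κ** (Zhan (2021), §2.2: "A two-sided whole-plane SLE_κ curve from `a`
  to `a` through `b` … The first arm of the curve is a whole-plane SLE_κ(2) curve from `a` to `b`.
  Given the first arm of the curve, the second arm of the curve is a chordal SLE_κ curve from `b` to
  `a` in the remaining domain"), here with `a = ∞`, `b = 0`: `IsTwoSidedWholePlaneSLEPair κ P η₁ η₂`
  says that on the probability space `(Ω, P)` the first arm `η₁ = 1/γ` is the image under `z ↦ 1/z`
  of a whole-plane SLE_κ(2) curve `γ` from `0` to `∞` (`IsWholePlaneSLEKappaRho κ 2`, file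
  `WholePlaneSLE`), and the second arm is `η₂ = Φ(η₁) ∘ (SLE_κ trace in ℍ)` for a uniformizer
  `Φ(η₁) : ℍ → Ĉ(η₁; ∞)` of the remaining domain (the unbounded component of `ℂ ∖ ({0} ∪ η₁)`,
  `armComplement`; the whole complement when the arm is simple, `κ ≤ 4`) with `0 ↦ 0`, `∞ ↦ ∞`,
  depending on `η₁` only, driven by a Brownian path independent of `η₁` — i.e. given `η₁`, `η₂` is
  chordal SLE_κ from `0` to `∞` in the remaining domain (the library's `sleTrace`,
  `Loewner.IsGeneratedByCurve`).
* **The natural law** `IsTwoSidedWholePlaneSLENatLaw κ μ`: `μ` (a measure on `C(ℝ, ℂ)`) is the law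
  of the unique parametrisation `γ̂` of the two-sided curve by `(1 + κ/8)`-dimensional Minkowski
  content with `γ̂(0) = 0`, `γ̂((-∞, 0])` the first arm (from `∞` to `0`) and `γ̂([0, ∞))` the
  second (Zhan (2021), Lemma 2.12 and Cor. 4.7: a.s. the curve possesses Minkowski content measure,
  parametrizable, with definition interval `ℝ`). `twoSidedWholePlaneSLENatLaw κ` is "the" law (by
  choice; characterised given the named facts `…exists` / `…unique`), and
  `twoSidedWholePlaneSLE83` its value at `κ = 8/3` (`d = 4/3`).
* **Named facts** (published theorems, `def … : Prop`): existence (Zhan (2021), §2.2, Lemma 2.12,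
  Cor. 4.7), well-definedness, and Zhan's Corollary 4.7 — `γ̂` is **self-similar of index `1/d`**
  (`map_dilatePath`) **with stationary increments** (`map_reroot`: invariance under re-rooting by
  natural length) — and reversibility (`map_reversePath`, Zhan (2021), §2.2 (i)).

What is NOT here. (a) Lawler–Lind (2007) (`LawlerLind2007`, two-sided SLE_{8/3} and the infinite
self-avoiding polygon; per zbMATH 1133.60036: two-sided radial SLE_{8/3} is obtained from two
independent radial SLE_{8/3} conditioned not to intersect, by limiting arguments) could not be
obtained (acquisition `acq-02663`); the identification, special to `κ = 8/3` (`c = 0`), of the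
two-sided whole-plane SLE_{8/3} with "two independent whole-plane SLE_{8/3} arms conditioned not to
intersect" is therefore NOT vendored here. (b) The route's "fusion property" (the two-sided law as a
fixed point of the fusion map `HasFusionLaw` / `IsFusionFixedPoint` of `FusionMap`) is a conjecture
of the route about this law, not literature, and is not asserted. (c) No Loewner or SDE analysis is
done here: all deep inputs are the named facts of `WholePlaneSLE` and of this file. (d) Rotation
invariance follows from the uniqueness of the stationary driving law (Miller–Sheffield (2013),
Prop. 2.1) but is not printed as such, so it is only the predicate `IsRotationInvariant`.

KNOWN DISCREPANCY (recorded by the proving seats of `…map_reroot` and `…map_dilatePath`; details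
and the correction in `TwoSidedWholePlaneSLEStationarity`, `TwoSidedWholePlaneSLEScaling`,
`UnrootedShiftInvariance`). In `IsTwoSidedWholePlaneSLEPair` the selector `Φ` of the uniformizer of
the remaining domain is NOT required to be measurable (and the probability space is arbitrary), so
the clause `η₂ = Φ(η₁) ∘ (SLE_κ trace of W)`, `W ⊥ η₁`, holds pointwise without pinning the
conditional law of the second arm given the first: the uniformizer is unique only up to a dilation
`λ(η₁) > 0` of `ℍ`, and on an enlarged probability space a non-measurable `λ(η₁)` can be made almost
surely equal to a non-constant functional of `W`, after which the second arm is, given the first,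
chordal SLE driven by a NON-Brownian path although every clause holds. Granted the existence of the
two-sided curve, the class `{μ | IsTwoSidedWholePlaneSLENatLaw κ μ}` is therefore strictly larger
than the single law `ν̂^#_{∞⇌0}` of Zhan (2021): the named facts `…NatLaw.unique`, `…map_reroot`,
`…map_dilatePath`, `…map_reversePath` below are stated over this larger class and are STRONGER than
their sources (for `unique` and `map_reroot`: false granted existence), and the chosen law
`twoSidedWholePlaneSLENatLaw κ` is not pinned to `ν̂^#_{∞⇌0}`. The faithful predicates add
`Measurable (Function.uncurry Φ)`: `IsTwoSidedWholePlaneSLEPairMeas` /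
`IsTwoSidedWholePlaneSLENatLawMeas` (`TwoSidedWholePlaneSLEStationarity`, with
`IsTwoSidedWholePlaneSLENatLawMeas.toNatLaw`); the corrected statements of Cor. 4.7 are the
conclusions of the proved implications `IsTwoSidedWholePlaneSLENatLaw.map_reroot_imp_meas` and
`IsTwoSidedWholePlaneSLENatLaw.map_dilatePath_imp_meas`, vendored (the RESTATEMENTS decided by the
reviews of those two facts) as the named facts `IsTwoSidedWholePlaneSLENatLawMeas.map_reroot`
(`TwoSidedWholePlaneSLEStationarity`) and `IsTwoSidedWholePlaneSLENatLawMeas.map_dilatePath`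
(`TwoSidedWholePlaneSLEScaling`), and Zhan's proof of the stationarity half
is formalised modulo its SLE-loop-measure input (Thm 4.1 (iv) of the arXiv version) as
`IsTwoSidedWholePlaneSLENatLawMeas.isRerootInvariant_of_timeSmear`. The statements in this file are
left verbatim (other files and the ledger reference them); consumers should migrate to the `…Meas`
predicates.

## References

* D. Zhan, *SLE loop measures*, PTRF 179 (2021), arXiv:1702.08026 (numbering of the arXiv
  version): §2.2 (two-sided whole-plane SLE_κ, reversibility (i)–(ii)), §2.3 Def. 2.1, Def. 2.3,
  Rem. 2.4 (Minkowski content measure, parametrisation), Lemma 2.12, Cor. 4.7. [Zhan2021SLELoopMeasures]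
* G. F. Lawler, M. A. Rezaei, *Minkowski content and natural parameterization for the
  Schramm–Loewner evolution*, Ann. Probab. 43 (2015), Thm 1.1, §2.2. [LawlerRezaei2015]
* G. F. Lawler, O. Schramm, W. Werner, *On the scaling limit of planar self-avoiding walk* (2004),
  arXiv:math/0204277, §3.4.6, §4.3 Predictions 7–8. [LawlerSchrammWerner2004SAW]
* G. F. Lawler, J. Lind, *Two-sided SLE_{8/3} and the infinite self-avoiding polygon*, Fields Inst.
  Commun. 50 (2007), 249–280. [LawlerLind2007]
* J. Miller, S. Sheffield, *Imaginary geometry IV* (2013/2017), Prop. 2.1, Thm 1.20, Thm 5.1. [MillerSheffield2013]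
-/

noncomputable section

open Set Filter Topology MeasureTheory ProbabilityTheory Complex
open UpperHalfPlane (upperHalfPlaneSet)
open Literature.Probability.RandomPlanarGeometry.RootedCurve (reroot)
open scoped NNReal Real ENNReal

namespace Literature.Probability.RandomPlanarGeometry

open scoped PathBorel

/-! ### Two-sided whole-plane SLE_κ: the two arms -/

section Arms

variable {Ω : Type*} [MeasurableSpace Ω]

/-- The **remaining domain of the first arm** `η` (running from `∞` to its tip `0`, closed trace
`{0} ∪ η(ℝ)` in `ℂ`): Zhan's `Ĉ(η; ∞)`, the connected component of `Ĉ ∖ η` whose boundary contains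
the starting point `∞` — in `ℂ`, the unbounded connected component of `ℂ ∖ ({0} ∪ η(ℝ))`
(`Loewner.unboundedComponent`, the union of the unbounded components; for the arms considered here it
is a.s. a single component, Zhan's condition `η ∈ Γ(Ĉ; ∞)`). For a simple arm (`κ ≤ 4`) this is the
whole complement `ℂ ∖ ({0} ∪ η(ℝ))`; for `κ ∈ (4, 8)` the arm has double points and the bounded
components it cuts off are excluded. Zhan (2021), §2.1 ("`Γ(Ĉ; z)` … the set of curves `γ` … such
that there is a unique connected component of `Ĉ ∖ γ` whose boundary contains `z` and has two prime
ends determined by `z` and `γ_tip` … Let `Ĉ(γ; z)` denote this connected component").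
[cite: Zhan2021SLELoopMeasures, §2.1] -/
def armComplement (η : ℝ → ℂ) : Set ℂ :=
  Loewner.unboundedComponent (insert 0 (range η))ᶜ

/-- The remaining domain lies in the complement of the closed trace of the arm. [folklore] -/
theorem armComplement_subset (η : ℝ → ℂ) : armComplement η ⊆ (insert 0 (range η))ᶜ :=
  Loewner.unboundedComponent_subset _

/-- `Φ : ℂ → ℂ` is (the boundary extension of) a **chordal uniformizer of the remaining domain of the
arm `η`, from its tip `0` to `∞`**: there is a conformal equivalence `φ : ℍ → armComplement η`
(Zhan's `Ĉ(η; ∞)`) with boundary value `0` at `0` (the prime end at the tip) and `∞` at `∞` (the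
prime end at the starting point `∞`), and `Φ = φ.boundaryExtension` on the closed half-plane. Such
`φ` is unique up to precomposition with a dilation of `ℍ`, under which the chordal SLE_κ law is
invariant modulo time change. Zhan (2021), §2.1 (`Ĉ(γ; z)`, prime ends at `z` and `γ_tip`) and §2.2
("chordal SLE_κ … is first defined in `ℍ` from `0` to `∞` … and then extended to other domains by
conformal maps"); cf. `DobrushinDomain.IsChordalUniformizing`. [cite: Zhan2021SLELoopMeasures, §2.2] -/
def IsArmUniformizer (η : ℝ → ℂ) (Φ : ℂ → ℂ) : Prop :=
  ∃ φ : ConformalEquiv upperHalfPlaneSet (armComplement η),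
    φ.HasBoundaryValue 0 0 ∧ Tendsto φ (cocompact ℂ ⊓ 𝓟 upperHalfPlaneSet) (cocompact ℂ) ∧
      EqOn Φ φ.boundaryExtension (closure upperHalfPlaneSet)

/-- **The two arms of a two-sided whole-plane SLE_κ from `∞` to `∞` through `0`** on a probability
space `(Ω, P)`: `η₁ : Ω → ℝ → ℂ` (first arm, from `∞` to `0`, whole-plane capacity time of its
inversion) and `η₂ : Ω → ℝ≥0 → ℂ` (second arm, from `0` to `∞`, half-plane capacity time).
Zhan (2021), §2.2: the first arm is a whole-plane SLE_κ(2) curve from `∞` to `0` — by Zhan (2021),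
§3, the image under the Möbius map `z ↦ 1/z` of a whole-plane SLE_κ(2) curve `γ` from `0` to `∞`
(`IsWholePlaneSLEKappaRho κ 2 P γ`); and "given the first arm of the curve, the second arm of the
curve is a chordal SLE_κ curve from `b` to `a` in the remaining domain" (`b = 0`, `a = ∞`): `η₂` is
the image of the SLE_κ trace in `ℍ` (`sleTrace`, driven by `√κ ×` a Brownian path `W` with the Wiener
law, **independent of `η₁`**) under a uniformizer `Φ(η₁)` of the remaining domain `Ĉ(η₁; ∞)`
(`armComplement`, from the tip `0` to `∞`) that depends on `ω` only through the first arm; almost surely the chordal chain is generated by its trace (Rohde–Schramm).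
CAVEAT (module docstring, KNOWN DISCREPANCY): `Φ` is not required to be measurable, so this
predicate does not pin the conditional law of `η₂` given `η₁`; the faithful version is
`IsTwoSidedWholePlaneSLEPairMeas` (`TwoSidedWholePlaneSLEStationarity`), which adds
`Measurable (Function.uncurry Φ)` and implies this one (`IsTwoSidedWholePlaneSLEPairMeas.toPair`).
[cite: Zhan2021SLELoopMeasures, §2.2] -/
def IsTwoSidedWholePlaneSLEPair (κ : ℝ≥0) (P : Measure Ω) (η₁ : Ω → ℝ → ℂ)
    (η₂ : Ω → ℝ≥0 → ℂ) : Prop :=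
  (∃ γ : Ω → ℝ → ℂ, IsWholePlaneSLEKappaRho κ 2 P γ ∧ ∀ ω t, η₁ ω t = (γ ω t)⁻¹) ∧
    (∀ t, Measurable fun ω ↦ η₂ ω t) ∧
    ∃ (W : Ω → ℝ≥0 → ℝ) (Φ : (ℝ → ℂ) → ℂ → ℂ), Measurable W ∧
      P.map W = Process.preWienerMeasure ∧ IndepFun η₁ W P ∧
      ∀ᵐ ω ∂P, IsArmUniformizer (η₁ ω) (Φ (η₁ ω)) ∧
        Loewner.IsGeneratedByCurve (sleDriving κ (W ω)) (sleTrace κ (W ω)) ∧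
        ∀ t, η₂ ω t = Φ (η₁ ω) (sleTrace κ (W ω) t)

/-- The first arm of a two-sided whole-plane SLE_κ pair is measurable (as a random path). [folklore] -/
theorem IsTwoSidedWholePlaneSLEPair.measurable_fst {κ : ℝ≥0} {P : Measure Ω} {η₁ : Ω → ℝ → ℂ}
    {η₂ : Ω → ℝ≥0 → ℂ} (h : IsTwoSidedWholePlaneSLEPair κ P η₁ η₂) : Measurable η₁ := by
  obtain ⟨⟨γ, hγ, hη⟩, -⟩ := h
  have : η₁ = fun ω t ↦ (γ ω t)⁻¹ := funext fun ω ↦ funext (hη ω)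
  rw [this]
  exact measurable_pi_lambda _ fun t ↦ (hγ.measurable_apply t).inv

/-- The second arm of a two-sided whole-plane SLE_κ pair is measurable (as a random path). [folklore] -/
theorem IsTwoSidedWholePlaneSLEPair.measurable_snd {κ : ℝ≥0} {P : Measure Ω} {η₁ : Ω → ℝ → ℂ}
    {η₂ : Ω → ℝ≥0 → ℂ} (h : IsTwoSidedWholePlaneSLEPair κ P η₁ η₂) : Measurable η₂ :=
  measurable_pi_lambda _ h.2.1

/-- The underlying measure of a two-sided whole-plane SLE_κ pair is a probability measure. [folklore] -/
theorem IsTwoSidedWholePlaneSLEPair.isProbabilityMeasure {κ : ℝ≥0} {P : Measure Ω}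
    {η₁ : Ω → ℝ → ℂ} {η₂ : Ω → ℝ≥0 → ℂ} (h : IsTwoSidedWholePlaneSLEPair κ P η₁ η₂) :
    IsProbabilityMeasure P := by
  obtain ⟨⟨γ, hγ, -⟩, -⟩ := h
  exact hγ.isProbabilityMeasure

end Arms

/-! ### The law in the natural parametrisation -/

section NatLaw

/-- **The law of two-sided whole-plane SLE_κ from `∞` to `∞` through `0` in its natural
parametrisation** (a measure `μ` on `C(ℝ, ℂ)`): `μ` is the law of a random two-sided path `γ̂`
which, almost surely, is parametrised by `(1 + κ/8)`-dimensional Minkowski content, is rooted at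
`γ̂(0) = 0`, traces the second arm on `[0, ∞)` and the first arm on `(-∞, 0)` (each through an
increasing change of time), the arms `(η₁, η₂)` forming a two-sided whole-plane SLE_κ pair.
Zhan (2021), §2.2 (the law `ν^#_{∞⇌0}`), Lemma 2.12 (a.s. the curve possesses Minkowski content
measure, parametrizable for the entire curve) and Cor. 4.7 (the Minkowski content parametrisation
`γ̂₀` with `γ̂₀(0) = 0`, defined on `ℝ`); Lawler–Rezaei (2015), Thm 1.1 (`d = 1 + κ/8`).
CAVEAT (module docstring, KNOWN DISCREPANCY): built on `IsTwoSidedWholePlaneSLEPair`, this class of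
laws is (granted existence) strictly larger than `{ν̂^#_{∞⇌0}}`; the faithful class is
`IsTwoSidedWholePlaneSLENatLawMeas` (`TwoSidedWholePlaneSLEStationarity`), contained in this one
(`IsTwoSidedWholePlaneSLENatLawMeas.toNatLaw`).
[cite: Zhan2021SLELoopMeasures, §2.2 / Cor. 4.7] -/
def IsTwoSidedWholePlaneSLENatLaw (κ : ℝ≥0) (μ : Measure C(ℝ, ℂ)) : Prop :=
  ∃ (Ω : Type) (_ : MeasurableSpace Ω) (P : Measure Ω) (η₁ : Ω → ℝ → ℂ) (η₂ : Ω → ℝ≥0 → ℂ)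
    (γ : Ω → C(ℝ, ℂ)), IsTwoSidedWholePlaneSLEPair κ P η₁ η₂ ∧ Measurable γ ∧ μ = P.map γ ∧
      ∀ᵐ ω ∂P, IsNaturallyParametrized (1 + (κ : ℝ) / 8) (γ ω) ∧ γ ω 0 = 0 ∧
        (∃ e : ℝ≥0 ≃o ℝ≥0, ∀ t : ℝ≥0, γ ω t = η₂ ω (e t)) ∧
        (∃ e' : Iio (0 : ℝ) ≃o ℝ, ∀ t : Iio (0 : ℝ), γ ω t = η₁ ω (e' t))

/-- A two-sided whole-plane SLE_κ natural law is a probability measure. [folklore] -/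
theorem IsTwoSidedWholePlaneSLENatLaw.isProbabilityMeasure {κ : ℝ≥0} {μ : Measure C(ℝ, ℂ)}
    (h : IsTwoSidedWholePlaneSLENatLaw κ μ) : IsProbabilityMeasure μ := by
  obtain ⟨Ω, _, P, η₁, η₂, γ, hpair, hγ, rfl, -⟩ := h
  haveI := hpair.isProbabilityMeasure
  exact Measure.isProbabilityMeasure_map hγ.aemeasurable

/-- `TwoSidedWholePlaneSLE κ μ` — the notion of the definition request under its requested name:
`μ` is the law, on two-sided paths `C(ℝ, ℂ)`, of **two-sided whole-plane SLE_κ from `∞` to `∞`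
through `0` in its natural parametrisation** (alias of `IsTwoSidedWholePlaneSLENatLaw`; for the
route: `TwoSidedWholePlaneSLE (8/3) μ`). Zhan (2021), §2.2 and Cor. 4.7. [cite: Zhan2021SLELoopMeasures, §2.2 / Cor. 4.7] -/
abbrev TwoSidedWholePlaneSLE (κ : ℝ≥0) (μ : Measure C(ℝ, ℂ)) : Prop :=
  IsTwoSidedWholePlaneSLENatLaw κ μ

open Classical in
/-- **"The" two-sided whole-plane SLE_κ natural law** `ν̂^#_{∞⇌0}`: a law satisfying
`IsTwoSidedWholePlaneSLENatLaw κ` when one exists (it does for `0 < κ < 8`, named fact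
`IsTwoSidedWholePlaneSLENatLaw.exists`, and is then unique, `IsTwoSidedWholePlaneSLENatLaw.unique`),
and the documented junk value `0` otherwise — the pattern of `Loewner.trace` / `Process.brownian`.
Zhan (2021), §2.2 and Cor. 4.7. CAVEAT (module docstring, KNOWN DISCREPANCY): the choice is made in
the larger class `IsTwoSidedWholePlaneSLENatLaw κ`, which (granted existence) is not a singleton, so
this law is not pinned to Zhan's `ν̂^#_{∞⇌0}` until the choice is made in
`IsTwoSidedWholePlaneSLENatLawMeas κ`. [cite: Zhan2021SLELoopMeasures, Cor. 4.7] -/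
def twoSidedWholePlaneSLENatLaw (κ : ℝ≥0) : Measure C(ℝ, ℂ) :=
  if h : ∃ μ, IsTwoSidedWholePlaneSLENatLaw κ μ then h.choose else 0

/-- When some law qualifies, `twoSidedWholePlaneSLENatLaw κ` qualifies. [folklore] -/
theorem isTwoSidedWholePlaneSLENatLaw_of_exists {κ : ℝ≥0} (h : ∃ μ, IsTwoSidedWholePlaneSLENatLaw κ μ) :
    IsTwoSidedWholePlaneSLENatLaw κ (twoSidedWholePlaneSLENatLaw κ) := by
  rw [twoSidedWholePlaneSLENatLaw, dif_pos h]
  exact h.choose_spec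

/-- **Two-sided whole-plane SLE_{8/3} through the origin with its natural parametrisation**
(`κ = 8/3`, `d = 4/3`): the law on `C(ℝ, ℂ)` that the route `SAWDimerizationRG` identifies as the
conjectured scaling limit of the two-sided infinite self-avoiding walk (Lawler–Schramm–Werner
(2004), §3.4.6, §4.3 Predictions 7–8; Lawler–Lind (2007)). [cite: LawlerSchrammWerner2004SAW, §4.3 Prediction 7–8] -/
abbrev twoSidedWholePlaneSLE83 : Measure C(ℝ, ℂ) :=
  twoSidedWholePlaneSLENatLaw (8 / 3)

/-- The **law of the window `[0, T]` after the root** of the two-sided whole-plane SLE_κ natural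
law, a law on the naturally parametrised rooted curves `RootedCurve ℂ` of `FusionMap` (push-forward
under the measurable `rootedWindow T`); `T = 1`: the unit natural-length window, the object the route
`SAWDimerizationRG` compares with its canonical unit-window law. [folklore] -/
def twoSidedWholePlaneSLEWindowLaw (κ : ℝ≥0) (T : ℝ) : Measure (RootedCurve ℂ) :=
  (twoSidedWholePlaneSLENatLaw κ).map (rootedWindow T)

/-- The window law is a probability measure as soon as the natural law is one. [folklore] -/
theorem isProbabilityMeasure_twoSidedWholePlaneSLEWindowLaw {κ : ℝ≥0}
    (h : IsTwoSidedWholePlaneSLENatLaw κ (twoSidedWholePlaneSLENatLaw κ)) (T : ℝ) :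
    IsProbabilityMeasure (twoSidedWholePlaneSLEWindowLaw κ T) := by
  haveI := h.isProbabilityMeasure
  exact Measure.isProbabilityMeasure_map (measurable_rootedWindow T).aemeasurable

/-! ### Named facts: existence, well-definedness, and Zhan's Corollary 4.7 -/

/-- **Existence** (named fact): for `0 < κ < 8` there is a two-sided whole-plane SLE_κ natural law —
the two-sided whole-plane SLE_κ curve exists (whole-plane SLE_κ(2) arm: Miller–Sheffield (2013),
Prop. 2.1 and Prop. 2.5, Lawler (2005), Prop. 4.21; chordal arm: Rohde–Schramm) and almost surely
possesses Minkowski content measure, parametrizable for the entire curve, its Minkowski content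
parametrisation rooted at `0` being defined on all of `ℝ`. Zhan (2021), §2.2, Lemma 2.12, Cor. 4.7.
(Regarding the KNOWN DISCREPANCY of the module docstring: existence in this larger class is implied by
existence in the faithful class `IsTwoSidedWholePlaneSLENatLawMeas κ`, via
`IsTwoSidedWholePlaneSLENatLawMeas.toNatLaw`; the intended content is the latter.)
[cite: Zhan2021SLELoopMeasures, Lemma 2.12] -/
def IsTwoSidedWholePlaneSLENatLaw.exists : Prop :=
  ∀ κ : ℝ≥0, 0 < κ → κ < 8 → ∃ μ : Measure C(ℝ, ℂ), IsTwoSidedWholePlaneSLENatLaw κ μ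

/-- **Well-definedness** (named fact, ASSEMBLED from the cited ingredients rather than one printed
theorem): two laws qualifying as the two-sided whole-plane SLE_κ natural law coincide (the
stationary driving law is unique, Miller–Sheffield (2013), Prop. 2.1; the
whole-plane Loewner chain and its curve are determined by the driving function, Lawler (2005),
Prop. 4.21; the chordal SLE_κ law in the remaining domain does not depend on the uniformizer,
Rohde–Schramm (2005), §2; the Minkowski content parametrisation rooted at `0` is unique, Zhan (2021),
Rem. 2.4 and proof of Cor. 4.7 ("there is a unique Minkowski content parametrization of `γ`,
denoted by `𝒫(γ)`, such that `𝒫(γ)(0) = 0`")). DISCREPANCY (module docstring): over the class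
`IsTwoSidedWholePlaneSLENatLaw κ` (non-measurable uniformizer selector allowed) this is stronger than
the assembled sources and fails granted existence; the faithful statement is the same over
`IsTwoSidedWholePlaneSLENatLawMeas κ` (its parametrisation half, "the arms determine the natural
law", is proved: `map_natParam_eq_of_arms` in `TwoSidedWholePlaneSLEProofs`). [cite: Zhan2021SLELoopMeasures, §2.2] -/
def IsTwoSidedWholePlaneSLENatLaw.unique : Prop :=
  ∀ (κ : ℝ≥0) (μ μ' : Measure C(ℝ, ℂ)),
    IsTwoSidedWholePlaneSLENatLaw κ μ → IsTwoSidedWholePlaneSLENatLaw κ μ' → μ = μ'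

/-- **Stationary increments / invariance under re-rooting by natural length** (named fact): the
two-sided whole-plane SLE_κ natural law is invariant under `reroot s` for every `s ∈ ℝ`. Zhan (2021),
Cor. 4.7 ("`γ̂₀` is a self-similar process of index `1/d` defined on `ℝ` with stationary
increments"; proof: invariance of the law under `𝒯₁ : γ̂ ↦ γ̂(· + 1) - γ̂(1)`, whence under all
shifts by self-similarity). DISCREPANCY (module docstring; verdict of the proving seat: misstated):
Cor. 4.7 concerns the one law `ν̂^#_{∞⇌0}`, whereas the class `IsTwoSidedWholePlaneSLENatLaw κ`
(non-measurable uniformizer selector allowed) is, granted existence, larger and contains laws that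
are not re-rooting invariant; the corrected statement is the conclusion of the proved implication
`IsTwoSidedWholePlaneSLENatLaw.map_reroot_imp_meas` (over `IsTwoSidedWholePlaneSLENatLawMeas κ`,
file `TwoSidedWholePlaneSLEStationarity`), and Zhan's proof of it is formalised modulo the rooted
SLE loop measure decomposition (Thm 4.1 (iv), arXiv numbering) as
`IsTwoSidedWholePlaneSLENatLawMeas.isRerootInvariant_of_timeSmear` (`UnrootedShiftInvariance`).
RESTATED (review of this fact, 2026-08-15): the source's statement is vendored as the named fact
`IsTwoSidedWholePlaneSLENatLawMeas.map_reroot` (`TwoSidedWholePlaneSLEStationarity`), which this one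
implies (`IsTwoSidedWholePlaneSLENatLawMeas.map_reroot_of_natLaw`) and which new work should take as
its hypothesis; the present declaration is kept unchanged only because those two theorems and
`IsTwoSidedWholePlaneSLENatLaw.isRerootInvariant` below mention it by name.
[cite: Zhan2021SLELoopMeasures, Cor. 4.7] -/
def IsTwoSidedWholePlaneSLENatLaw.map_reroot : Prop :=
  ∀ (κ : ℝ≥0) (μ : Measure C(ℝ, ℂ)), 0 < κ → κ < 8 → IsTwoSidedWholePlaneSLENatLaw κ μ →
    ∀ s : ℝ, μ.map (reroot s) = μ

/-- **Self-similarity of index `1/d`, `d = 1 + κ/8`** (named fact): the two-sided whole-plane SLE_κ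
natural law is invariant under `γ ↦ a^{1/d} · γ(· / a)` for every `a > 0` (exact scale invariance,
`ν = 1/d`). Zhan (2021), Cor. 4.7 (from the scaling invariance of `ν^#_{∞⇌0}` and the scaling
covariance of the Minkowski content measure). DISCREPANCY (module docstring): stated over the
larger class `IsTwoSidedWholePlaneSLENatLaw κ`, stronger than the source; the corrected statement is
the conclusion of the proved implication `IsTwoSidedWholePlaneSLENatLaw.map_dilatePath_imp_meas`
(over `IsTwoSidedWholePlaneSLENatLawMeas κ`, file `TwoSidedWholePlaneSLEScaling`, with the reductions
of its proof), vendored there (RESTATED likewise) as the named fact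
`IsTwoSidedWholePlaneSLENatLawMeas.map_dilatePath`, which this one implies
(`IsTwoSidedWholePlaneSLENatLaw.map_dilatePath_imp_natLawMeas`). [cite: Zhan2021SLELoopMeasures, Cor. 4.7] -/
def IsTwoSidedWholePlaneSLENatLaw.map_dilatePath : Prop :=
  ∀ (κ : ℝ≥0) (μ : Measure C(ℝ, ℂ)), 0 < κ → κ < 8 → IsTwoSidedWholePlaneSLENatLaw κ μ →
    ∀ a : ℝ, 0 < a → μ.map (dilatePath (1 / (1 + (κ : ℝ) / 8)) a) = μ

/-- **Reversibility** (named fact): the two-sided whole-plane SLE_κ natural law is invariant under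
`γ ↦ γ(-·)` (the reversal is again parametrised by Minkowski content and rooted at `0`).
Zhan (2021), §2.2 ("(i) the reversal of `γ` has the same law (modulo a time change) as `γ`", from
the reversibility of whole-plane SLE_κ(2), Miller–Sheffield (2013), Thm 1.20, and of chordal SLE_κ)
together with Rem. 2.4. DISCREPANCY (module docstring): stated over the larger class
`IsTwoSidedWholePlaneSLENatLaw κ`, stronger than the source; the faithful statement is the same over
`IsTwoSidedWholePlaneSLENatLawMeas κ` (not yet vendored; the parametrisation layer of the transfer is
proved in `TwoSidedWholePlaneSLEProofs`). [cite: Zhan2021SLELoopMeasures, §2.2] -/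
def IsTwoSidedWholePlaneSLENatLaw.map_reversePath : Prop :=
  ∀ (κ : ℝ≥0) (μ : Measure C(ℝ, ℂ)), 0 < κ → κ < 8 → IsTwoSidedWholePlaneSLENatLaw κ μ →
    μ.map reversePath = μ

/-- Given Zhan's Corollary 4.7 (hypothesis `h47 : map_reroot`), every two-sided whole-plane SLE_κ
natural law (`0 < κ < 8`) is re-rooting invariant. [cite: Zhan2021SLELoopMeasures, Cor. 4.7] -/
theorem IsTwoSidedWholePlaneSLENatLaw.isRerootInvariant (h47 : IsTwoSidedWholePlaneSLENatLaw.map_reroot)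
    {κ : ℝ≥0} {μ : Measure C(ℝ, ℂ)} (hκ : 0 < κ) (hκ' : κ < 8)
    (h : IsTwoSidedWholePlaneSLENatLaw κ μ) : IsRerootInvariant μ :=
  h47 κ μ hκ hκ' h

/-- Given Zhan's Corollary 4.7 (hypothesis `h47 : map_dilatePath`), every two-sided whole-plane SLE_κ
natural law (`0 < κ < 8`) is self-similar of index `ν = 1/(1 + κ/8)`. [cite: Zhan2021SLELoopMeasures, Cor. 4.7] -/
theorem IsTwoSidedWholePlaneSLENatLaw.isSelfSimilar (h47 : IsTwoSidedWholePlaneSLENatLaw.map_dilatePath)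
    {κ : ℝ≥0} {μ : Measure C(ℝ, ℂ)} (hκ : 0 < κ) (hκ' : κ < 8)
    (h : IsTwoSidedWholePlaneSLENatLaw κ μ) : IsSelfSimilar (1 / (1 + (κ : ℝ) / 8)) μ :=
  h47 κ μ hκ hκ' h

/-- For `κ = 8/3` the natural parametrisation is `4/3`-dimensional Minkowski content
(`1 + (8/3)/8 = 4/3`). [folklore] -/
theorem dim_eightThirds : (1 + ((8 / 3 : ℝ≥0) : ℝ) / 8 : ℝ) = 4 / 3 := by
  push_cast; norm_num

/-- For `κ = 8/3` the self-similarity index is `ν = 1/d = 3/4`. [folklore] -/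
theorem selfSimilarIndex_eightThirds : (1 / (1 + ((8 / 3 : ℝ≥0) : ℝ) / 8) : ℝ) = 3 / 4 := by
  push_cast; norm_num

/-- Given the existence fact, the two-sided whole-plane SLE_{8/3} law `twoSidedWholePlaneSLE83` is a
two-sided whole-plane SLE_{8/3} natural law (in particular a probability measure whose paths are
a.s. parametrised by `4/3`-dimensional Minkowski content and rooted at `0`).
[cite: Zhan2021SLELoopMeasures, Cor. 4.7] -/
theorem isTwoSidedWholePlaneSLENatLaw_eightThirds (hex : IsTwoSidedWholePlaneSLENatLaw.exists) :
    IsTwoSidedWholePlaneSLENatLaw (8 / 3) twoSidedWholePlaneSLE83 :=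
  isTwoSidedWholePlaneSLENatLaw_of_exists (hex _ (by norm_num) (by norm_num))

/-- Given the existence fact, `twoSidedWholePlaneSLE83` is a `TwoSidedWholePlaneSLE (8/3)` law.
[cite: Zhan2021SLELoopMeasures, Cor. 4.7] -/
theorem twoSidedWholePlaneSLE_eightThirds (hex : IsTwoSidedWholePlaneSLENatLaw.exists) :
    TwoSidedWholePlaneSLE (8 / 3) twoSidedWholePlaneSLE83 :=
  isTwoSidedWholePlaneSLENatLaw_eightThirds hex

end NatLaw

end Literature.Probability.RandomPlanarGeometry
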